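import Mathlib
import Summits.AtomisticToContinuum.HydrodynamicLimit.Theorems.InformationPercolationEngineKickFairRelEquilibriumMesoConditionThePastDefs
import Summits.AtomisticToContinuum.HydrodynamicLimit.Theorems.InformationPercolationEngineKickFairRelEquilibriumMesoTransferAE
import Summits.AtomisticToContinuum.HydrodynamicLimit.Theorems.InformationPercolationEngineKickFairRelEquilibriumMesoPastMeasurable
import Summits.AtomisticToContinuum.HydrodynamicLimit.Theorems.InformationPercolationEngineKickFairRelEquilibriumMesoNoLastCollision
import Literature.MathematicalPhysics.KineticTheory.LocalGibbsConstEquivalence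
import HarnessLib

/-!
# `KickFairRelEquilibriumMeso`, line `condition-the-past` — stub Red-B, part 1: the finite family behind the
# truncated fluctuation (set-up for the abstract pair expansion)

Helper file (`--supports stmt-AtomisticToContinuum-15177`) of the line lead (c7) for the registered stub
`stub_reductionB : PairExpansion → PairInnovationBias rs → UnorderedPairWeight rs → TruncatedFluctuation rs` of the skeleton
`Cruxes/KickFairRelEquilibriumMeso/Lines/condition_the_past.lean` (rev 2). The abstract pair expansion `PairExpansion` is
applied to the finite family indexed by `Fin (N+1) × Fin M` (sphere, collision index below the truncation level
`M = idxCut A N = ⌈A (N+1)^{1/3}⌉₊`), built from the following `(i, n)`-indexed objects: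

* `pastSA Φ r i n` — the comap σ-algebra of the typed past of `(i, n)` (the `m k` of `PairExpansion`);
* `tripleMap` / `pairSA Φ r g i n i' n'` — the past of `(i', n')` enriched by the past and the compensated outcome of
  `(i, n)` (the `mA k l`; its conditional expectation of `D_{i',n'}` is `betaLG2 … i n i' n'` by definition);
* `wt Φ τ r h i n` — the weight `1_{t_{i,n} ∈ (0,τ]} · h_{i,n}(P_{i,n})`, a Borel function OF THE PAST (the `w k`), dominated by
  the indicator of the validity event `validEv` (`t_{i,n} ∈ (0, τ]`, the `v k`); `ordEv` — the time order `Precedes P_{i,n} P_{i',n'}`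
  (the `o k l`).

This file checks the standing hypotheses of `PairExpansion` for these data (sub-σ-algebra inclusions by
`MeasurableSpace.comap_comp` / `comap_mono`; measurability of the weight, the validity and the order events through the past
maps, `measurableSet_precedes`), and proves the two a.e. facts under the LOCAL Gibbs law that drive the instantiation:
`|kickDev| ≤ 2C` a.e. (from `|κ| ≤ C` under the invariant law, moved by mutual absolute continuity of local Gibbs laws) and the
a.e. genuineness of the cut (`n < cnt_i ↔ t_{i,n} ∈ (0, τ]`, `ae_lt_cnt_iff_mem_Ioc` moved the same way) — whence THE TRUNCATED
FLUCTUATION SUM IS A.E. THE WEIGHTED CENTRED SUM OVER THE FINITE FAMILY (`truncSum_ae_eq`, registered sub-goal). Part 2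
(`…MesoReductionB.lean`) does the Cauchy–Schwarz step and the bookkeeping.
-/

noncomputable section

open MeasureTheory Set Filter Topology
open scoped ENNReal Classical

namespace Summit.AtomisticToContinuum.HydrodynamicLimit.Theorems.KickFairRelEquilibriumMesoLine

open Literature.Analysis.FluidPDE Literature.MathematicalPhysics.KineticTheory

variable {σ : ℝ} {N : ℕ}

/-! ## The objects -/

/-- The truncation level `⌈A (N+1)^{1/3}⌉₊` of the collision index (so that `n < idxCut A N ↔ (n : ℝ) < A (N+1)^{1/3}`). -/
def idxCut (A : ℝ) (N : ℕ) : ℕ := ⌈A * ((N : ℝ) + 1) ^ (1 / 3 : ℝ)⌉₊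

/-- `n < idxCut A N ↔ (n : ℝ) < A (N+1)^{1/3}`. [folklore] -/
theorem lt_idxCut_iff {A : ℝ} {N n : ℕ} : n < idxCut A N ↔ (n : ℝ) < A * ((N : ℝ) + 1) ^ (1 / 3 : ℝ) :=
  Nat.lt_ceil

/-- The comap σ-algebra of the typed past of the collision `(i, n)` (the `m k` of `PairExpansion`). -/
@[reducible] def pastSA (Φ : Flow σ N) (r : ℝ) (i : Fin (N + 1)) (n : ℕ) : MeasurableSpace (Phase N) :=
  MeasurableSpace.comap (fun z => past Φ r z i n) inferInstance

/-- The enrichment map of the ordered pair `((i,n), (i',n'))`: the past of `(i', n')`, the past of `(i, n)`, the compensated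
outcome of `(i, n)` (the map whose comap σ-algebra defines `betaLG2 … i n i' n'`). -/
def tripleMap (Φ : Flow σ N) (r : ℝ) (g : V3 × V3 × V3 → ℝ) (i : Fin (N + 1)) (n : ℕ) (i' : Fin (N + 1)) (n' : ℕ)
    (z : Phase N) : Past N × Past N × ℝ :=
  (past Φ r z i' n', past Φ r z i n, kickDev Φ r g i n z)

/-- The enlarged σ-algebra of the pair (the `mA k l` of `PairExpansion`): comap of `tripleMap`. -/
@[reducible] def pairSA (Φ : Flow σ N) (r : ℝ) (g : V3 × V3 × V3 → ℝ) (i : Fin (N + 1)) (n : ℕ) (i' : Fin (N + 1)) (n' : ℕ) :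
    MeasurableSpace (Phase N) :=
  MeasurableSpace.comap (tripleMap Φ r g i n i' n') inferInstance

/-- The weight read off the past: `1_{t ∈ (0, τ]} · h_{i,n}(p)` as a function on `Past N`. -/
def wtFun (τ : ℝ) (h : Fin (N + 1) → ℕ → Past N → ℝ) (i : Fin (N + 1)) (n : ℕ) (p : Past N) : ℝ :=
  (if p.2.2.2 ∈ Set.Ioc 0 τ then (1 : ℝ) else 0) * h i n p

/-- The weight of the collision `(i, n)` along the orbit of `z` (the `w k` of `PairExpansion`): `wtFun` of its typed past. -/
def wt (Φ : Flow σ N) (τ r : ℝ) (h : Fin (N + 1) → ℕ → Past N → ℝ) (i : Fin (N + 1)) (n : ℕ) (z : Phase N) : ℝ :=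
  wtFun τ h i n (past Φ r z i n)

/-- The validity event of `(i, n)` (the `v k` of `PairExpansion`): its collision time, read off the past, lies in `(0, τ]`. -/
def validEv (Φ : Flow σ N) (τ r : ℝ) (i : Fin (N + 1)) (n : ℕ) : Set (Phase N) :=
  (fun z => past Φ r z i n) ⁻¹' {p : Past N | p.2.2.2 ∈ Set.Ioc 0 τ}

/-- The order event "`(i,n)` before `(i',n')`" (the `o k l` of `PairExpansion`): `Precedes P_{i,n} P_{i',n'}`. -/
def ordEv (Φ : Flow σ N) (r : ℝ) (i : Fin (N + 1)) (n : ℕ) (i' : Fin (N + 1)) (n' : ℕ) : Set (Phase N) :=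
  {z | Precedes (past Φ r z i n) (past Φ r z i' n')}

/-! ## The standing hypotheses of `PairExpansion` for these data -/

section Hypotheses

variable (Φ : Flow σ N) (r : ℝ) (g : V3 × V3 × V3 → ℝ)

/-- `kickDev` is Borel measurable (continuous `g`, `PastMeasurable`). [folklore] -/
theorem measurable_kickDev {g : V3 × V3 × V3 → ℝ} (hg : Continuous g) (i : Fin (N + 1)) (n : ℕ) :
    Measurable (kickDev Φ r g i n) := by
  unfold kickDev kappa
  exact (hg.measurable.comp (measurable_kick Φ i n)).sub
    ((stronglyMeasurable_condExp.measurable).mono (measurable_past Φ r i n).comap_le le_rfl)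

/-- The enrichment map is Borel measurable. [folklore] -/
theorem measurable_tripleMap {g : V3 × V3 × V3 → ℝ} (hg : Continuous g) (i : Fin (N + 1)) (n : ℕ)
    (i' : Fin (N + 1)) (n' : ℕ) : Measurable (tripleMap Φ r g i n i' n') :=
  (measurable_past Φ r i' n').prodMk ((measurable_past Φ r i n).prodMk (measurable_kickDev Φ r hg i n))

/-- `m k ≤ m0`. [folklore] -/
theorem pastSA_le (i : Fin (N + 1)) (n : ℕ) : pastSA Φ r i n ≤ (inferInstance : MeasurableSpace (Phase N)) :=
  (measurable_past Φ r i n).comap_le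

/-- `mA k l ≤ m0`. [folklore] -/
theorem pairSA_le {g : V3 × V3 × V3 → ℝ} (hg : Continuous g) (i : Fin (N + 1)) (n : ℕ) (i' : Fin (N + 1))
    (n' : ℕ) : pairSA Φ r g i n i' n' ≤ (inferInstance : MeasurableSpace (Phase N)) :=
  (measurable_tripleMap Φ r hg i n i' n').comap_le

/-- `m k ≤ mA k l` (the past of `k = (i,n)` is the middle component of the enrichment map). [folklore] -/
theorem pastSA_le_pairSA_left (i : Fin (N + 1)) (n : ℕ) (i' : Fin (N + 1)) (n' : ℕ) :
    pastSA Φ r i n ≤ pairSA Φ r g i n i' n' := by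
  have h : (fun z => past Φ r z i n) = (fun t : Past N × Past N × ℝ => t.2.1) ∘ tripleMap Φ r g i n i' n' := rfl
  unfold pastSA pairSA
  rw [h, ← MeasurableSpace.comap_comp]
  exact MeasurableSpace.comap_mono (measurable_snd.fst).comap_le

/-- `m l ≤ mA k l` (the past of `l = (i',n')` is the first component of the enrichment map). [folklore] -/
theorem pastSA_le_pairSA_right (i : Fin (N + 1)) (n : ℕ) (i' : Fin (N + 1)) (n' : ℕ) :
    pastSA Φ r i' n' ≤ pairSA Φ r g i n i' n' := by
  have h : (fun z => past Φ r z i' n') = (fun t : Past N × Past N × ℝ => t.1) ∘ tripleMap Φ r g i n i' n' := rfl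
  unfold pastSA pairSA
  rw [h, ← MeasurableSpace.comap_comp]
  exact MeasurableSpace.comap_mono measurable_fst.comap_le

/-- `D k` is `mA k l`-measurable (it is the last component of the enrichment map). [folklore] -/
theorem stronglyMeasurable_kickDev_pairSA (i : Fin (N + 1)) (n : ℕ) (i' : Fin (N + 1)) (n' : ℕ) :
    StronglyMeasurable[pairSA Φ r g i n i' n'] (kickDev Φ r g i n) := by
  have h : kickDev Φ r g i n = (fun t : Past N × Past N × ℝ => t.2.2) ∘ tripleMap Φ r g i n i' n' := rfl
  refine Measurable.stronglyMeasurable ?_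
  rw [h]
  exact measurable_snd.snd.comp (comap_measurable _)

/-- The weight function on the past is Borel (measurable `h`). [folklore] -/
theorem measurable_wtFun (τ : ℝ) {h : Fin (N + 1) → ℕ → Past N → ℝ} (hh : ∀ i n, Measurable (h i n)) (i : Fin (N + 1))
    (n : ℕ) : Measurable (wtFun τ h i n) := by
  unfold wtFun
  refine Measurable.mul (Measurable.ite ?_ measurable_const measurable_const) (hh i n)
  exact measurableSet_Ioc.preimage (measurable_snd.comp (measurable_snd.comp measurable_snd))

/-- `w k` is `m k`-measurable (a Borel function of the past of `k`). [folklore] -/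
theorem stronglyMeasurable_wt (τ : ℝ) {h : Fin (N + 1) → ℕ → Past N → ℝ} (hh : ∀ i n, Measurable (h i n))
    (i : Fin (N + 1)) (n : ℕ) : StronglyMeasurable[pastSA Φ r i n] (wt Φ τ r h i n) := by
  refine Measurable.stronglyMeasurable ?_
  exact (measurable_wtFun τ hh i n).comp (comap_measurable _)

/-- `v k` is an `m k`-event. [folklore] -/
theorem measurableSet_validEv (τ : ℝ) (i : Fin (N + 1)) (n : ℕ) : MeasurableSet[pastSA Φ r i n] (validEv Φ τ r i n) := by
  unfold validEv pastSA
  exact comap_measurable _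
    (measurableSet_Ioc.preimage (measurable_snd.comp (measurable_snd.comp measurable_snd)))

/-- `|w k| ≤ 1_{v k}` (`|h| ≤ 1`). [folklore] -/
theorem abs_wt_le (τ : ℝ) {h : Fin (N + 1) → ℕ → Past N → ℝ} (hhb : ∀ i n p, |h i n p| ≤ 1) (i : Fin (N + 1)) (n : ℕ)
    (z : Phase N) : |wt Φ τ r h i n z| ≤ (validEv Φ τ r i n).indicator (fun _ => (1 : ℝ)) z := by
  unfold wt wtFun validEv
  by_cases hz : (past Φ r z i n).2.2.2 ∈ Set.Ioc 0 τ
  · rw [if_pos hz, one_mul, Set.indicator_of_mem (by simpa using hz)]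
    exact hhb _ _ _
  · rw [if_neg hz, zero_mul, abs_zero]
    exact Set.indicator_nonneg (fun _ _ => zero_le_one) _

/-- `o k l` is an `mA k l`-event (`Precedes` is Borel in the pair of pasts, `measurableSet_precedes`). [folklore] -/
theorem measurableSet_ordEv (i : Fin (N + 1)) (n : ℕ) (i' : Fin (N + 1)) (n' : ℕ) :
    MeasurableSet[pairSA Φ r g i n i' n'] (ordEv Φ r i n i' n') := by
  have h : ordEv Φ r i n i' n' = tripleMap Φ r g i n i' n' ⁻¹'
      ((fun t : Past N × Past N × ℝ => (t.2.1, t.1)) ⁻¹' {q : Past N × Past N | Precedes q.1 q.2}) := rfl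
  rw [h]
  exact comap_measurable _
    ((measurableSet_precedes N).preimage (measurable_snd.fst.prodMk measurable_fst))

/-- `o l k` is an `mA k l`-event as well. [folklore] -/
theorem measurableSet_ordEv_swap (i : Fin (N + 1)) (n : ℕ) (i' : Fin (N + 1)) (n' : ℕ) :
    MeasurableSet[pairSA Φ r g i n i' n'] (ordEv Φ r i' n' i n) := by
  have h : ordEv Φ r i' n' i n = tripleMap Φ r g i n i' n' ⁻¹'
      ((fun t : Past N × Past N × ℝ => (t.1, t.2.1)) ⁻¹' {q : Past N × Past N | Precedes q.1 q.2}) := rfl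
  rw [h]
  exact comap_measurable _
    ((measurableSet_precedes N).preimage (measurable_fst.prodMk measurable_snd.fst))

/-- The two conditional expectations of `PairExpansion` are the line's `betaLG` and `betaLG2` (definitionally). [folklore] -/
theorem condExp_pastSA_eq (a₀ θ₀ : T3 → ℝ) (u₀ : T3 → V3) (i : Fin (N + 1)) (n : ℕ) :
    (localGibbsLaw σ a₀ u₀ θ₀ N Φ)[kickDev Φ r g i n | pastSA Φ r i n] = betaLG σ a₀ θ₀ u₀ Φ r g i n := rfl

/-- See `condExp_pastSA_eq`. [folklore] -/
theorem condExp_pairSA_eq (a₀ θ₀ : T3 → ℝ) (u₀ : T3 → V3) (i : Fin (N + 1)) (n : ℕ) (i' : Fin (N + 1)) (n' : ℕ) :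
    (localGibbsLaw σ a₀ u₀ θ₀ N Φ)[kickDev Φ r g i' n' | pairSA Φ r g i n i' n'] =
      betaLG2 σ a₀ θ₀ u₀ Φ r g i n i' n' := rfl

end Hypotheses

/-! ## Two a.e. facts under the local Gibbs law -/

section AE

variable {a₀ θ₀ : T3 → ℝ} {u₀ : T3 → V3}

/-- The local Gibbs law is absolutely continuous w.r.t. the invariant law `G = localGibbsLaw σ 1 0 1` (`σ ≤ 1/2`). [folklore] -/
theorem localGibbsLaw_ac_invariant (hσ2 : σ ≤ 1 / 2) (Φ : Flow σ N) :
    localGibbsLaw σ a₀ u₀ θ₀ N Φ ≪ localGibbsLaw σ (fun _ => 1) (fun _ => 0) (fun _ => 1) N Φ :=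
  localGibbsLaw_absolutelyContinuous_localGibbsLaw continuous_const continuous_const continuous_const
    (fun _ => one_pos) (fun _ => one_pos) a₀ u₀ θ₀ hσ2 N Φ

/-- **`|D_{i,n}| ≤ 2C` for all `i, n`, `LG`-a.e.** (`|g| ≤ C`; `|κ| ≤ C` `G`-a.e., moved to `LG`). [folklore] -/
theorem ae_forall_abs_kickDev_le (hσ2 : σ ≤ 1 / 2) (Φ : Flow σ N) (r : ℝ) {g : V3 × V3 × V3 → ℝ} {C : ℝ}
    (hg : ∀ p, |g p| ≤ C) :
    ∀ᵐ z ∂(localGibbsLaw σ a₀ u₀ θ₀ N Φ), ∀ i : Fin (N + 1), ∀ n : ℕ, |kickDev Φ r g i n z| ≤ 2 * C := by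
  filter_upwards [(localGibbsLaw_ac_invariant hσ2 Φ).ae_le (ae_forall_abs_kappa_le Φ r hg)] with z hz
  intro i n
  unfold kickDev
  have h1 := hg (kick Φ i n z)
  have h2 := hz i n
  calc |g (kick Φ i n z) - kappa Φ r g i n z| ≤ |g (kick Φ i n z)| + |kappa Φ r g i n z| := abs_sub _ _
    _ ≤ 2 * C := by linarith

/-- **The cut is genuine `LG`-a.e.**: almost surely, for all `i, n`, `n < cnt_i(τ)` iff the collision time read off the typed
past lies in `(0, τ]` (`ae_lt_cnt_iff_mem_Ioc` under the invariant law, moved to `LG`; on the good set the past carries the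
`n`-th collision time). [folklore] -/
theorem ae_forall_lt_cnt_iff_pastTime (hσ2 : σ ≤ 1 / 2) (Φ : Flow σ N) (τ r : ℝ) :
    ∀ᵐ z ∂(localGibbsLaw σ a₀ u₀ θ₀ N Φ), ∀ i : Fin (N + 1), ∀ n : ℕ,
      n < cnt Φ τ z i ↔ (past Φ r z i n).2.2.2 ∈ Set.Ioc 0 τ := by
  have hG : ∀ᵐ z ∂(localGibbsLaw σ (fun _ => 1) (fun _ => 0) (fun _ => 1) N Φ), ∀ i : Fin (N + 1), ∀ n : ℕ,
      n < cnt Φ τ z i ↔ Φ.nthCollisionTimeOf i n z ∈ Set.Ioc 0 τ := by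
    rw [ae_all_iff]; intro i
    exact ae_lt_cnt_iff_mem_Ioc one_pos one_pos 0 hσ2 Φ τ i
  have hgood : ∀ᵐ z ∂(localGibbsLaw σ a₀ u₀ θ₀ N Φ), z ∈ Φ.good :=
    mem_ae_iff.2 (localGibbsLaw_compl_good_eq_zero Φ)
  filter_upwards [(localGibbsLaw_ac_invariant hσ2 Φ).ae_le hG, hgood] with z hz hzg
  intro i n
  rw [hz i n, ← pastTime_of_mem_good Φ r hzg i n]
  rfl

end AE

/-! ## The truncated fluctuation sum is a.e. the weighted centred sum over the finite family -/

/-- Reindexing a doubly cut sum: `Σ_{n<a} 1_{n<b} T n = Σ_{n<b} 1_{n<a} T n`. [folklore] -/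
theorem sum_range_ite_lt_comm (T : ℕ → ℝ) (a b : ℕ) :
    ∑ n ∈ Finset.range a, (if n < b then (1 : ℝ) else 0) * T n =
      ∑ n ∈ Finset.range b, (if n < a then (1 : ℝ) else 0) * T n := by
  have key : ∀ a b : ℕ, ∑ n ∈ Finset.range a, (if n < b then (1 : ℝ) else 0) * T n =
      ∑ n ∈ Finset.range (min a b), T n := by
    intro a b
    rw [← Finset.sum_filter_add_sum_filter_not (Finset.range a) (fun n => n < b)]
    have h1 : (Finset.range a).filter (fun n => n < b) = Finset.range (min a b) := by
      ext n; simp [Finset.mem_filter, Finset.mem_range]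
    have h2 : ∑ n ∈ (Finset.range a).filter (fun n => n < b), (if n < b then (1 : ℝ) else 0) * T n =
        ∑ n ∈ Finset.range (min a b), T n := by
      rw [h1]
      refine Finset.sum_congr rfl fun n hn => ?_
      rw [if_pos ((lt_min_iff.1 (Finset.mem_range.1 hn)).2), one_mul]
    have h3 : ∑ n ∈ (Finset.range a).filter (fun n => ¬ n < b), (if n < b then (1 : ℝ) else 0) * T n = 0 :=
      Finset.sum_eq_zero fun n hn => by rw [if_neg (Finset.mem_filter.1 hn).2, zero_mul]
    rw [h2, h3, add_zero]
  rw [key a b, key b a, min_comm]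

/-- **The truncated fluctuation sum equals the weighted centred sum over `Fin (N+1) × Fin (idxCut A N)`, `LG`-a.e.**
(registered sub-goal `truncSum_ae_eq`): for `σ ≤ 1/2`, every flow, horizon, mesh, `g`, truncation parameter `A` and weight `h`,
almost surely under `localGibbsLaw σ a₀ u₀ θ₀ N Φ`,
`Σ_i Σ_{n<cnt_i} 1_{n < A(N+1)^{1/3}} h_{i,n}(P_{i,n}) (D_{i,n} − β_{i,n}) = Σ_{k} w_k (D_k − β_k)`. [folklore] -/
theorem truncSum_ae_eq : ∀ (σ : ℝ) (N : ℕ) (a₀ θ₀ : T3 → ℝ) (u₀ : T3 → V3), σ ≤ 1 / 2 →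
    ∀ (Φ : Flow σ N) (τ r : ℝ) (g : V3 × V3 × V3 → ℝ) (A : ℝ) (h : Fin (N + 1) → ℕ → Past N → ℝ),
    ∀ᵐ z ∂(localGibbsLaw σ a₀ u₀ θ₀ N Φ),
      ∑ i : Fin (N + 1), ∑ n ∈ Finset.range (cnt Φ τ z i),
          (if (n : ℝ) < A * ((N : ℝ) + 1) ^ (1 / 3 : ℝ) then (1 : ℝ) else 0) *
            (h i n (past Φ r z i n) * (kickDev Φ r g i n z - betaLG σ a₀ θ₀ u₀ Φ r g i n z)) =
        ∑ k : Fin (N + 1) × Fin (idxCut A N), wt Φ τ r h k.1 k.2 z *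
          (kickDev Φ r g k.1 k.2 z - betaLG σ a₀ θ₀ u₀ Φ r g k.1 k.2 z) := by
  intro σ N a₀ θ₀ u₀ hσ2 Φ τ r g A h
  filter_upwards [ae_forall_lt_cnt_iff_pastTime (a₀ := a₀) (θ₀ := θ₀) (u₀ := u₀) hσ2 Φ τ r] with z hz
  rw [Fintype.sum_prod_type]
  refine Finset.sum_congr rfl fun i _ => ?_
  -- the right-hand inner sum over `Fin (idxCut A N)` as a range sum
  rw [Fin.sum_univ_eq_sum_range (fun n => wt Φ τ r h i n z *
      (kickDev Φ r g i n z - betaLG σ a₀ θ₀ u₀ Φ r g i n z)) (idxCut A N)]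
  have hw : ∀ n : ℕ, wt Φ τ r h i n z * (kickDev Φ r g i n z - betaLG σ a₀ θ₀ u₀ Φ r g i n z) =
      (if n < cnt Φ τ z i then (1 : ℝ) else 0) *
        (h i n (past Φ r z i n) * (kickDev Φ r g i n z - betaLG σ a₀ θ₀ u₀ Φ r g i n z)) := by
    intro n
    unfold wt wtFun
    simp only [hz i n, mul_assoc]
  simp_rw [hw]
  rw [← sum_range_ite_lt_comm]
  refine Finset.sum_congr rfl fun n _ => ?_
  simp only [lt_idxCut_iff]

end Summit.AtomisticToContinuum.HydrodynamicLimit.Theorems.KickFairRelEquilibriumMesoLine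

end
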